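/-
Origin: expansion seat `planner-pub-hodgecm-qw8-g11-0`, handover #18 SPLIT PART 1/2 of tree `HodgeCM/Model/Toy/LefQuarticQuad.lean` 5e74bc2b (626 l. > 400-line cap) = NEW module `HodgeCM.Model.Toy.LefQuarticQuadLift` md5 cc8dddc49ffc0adad9e8993a2865523f (322 l.): verbatim section-boundary slice + docstrings; imports: NO rewrite (tree imports only: Mathlib, HodgeCM.Model.Toy.LefQuadMixed); check-wip LANDABLE rc 0 / 0 warnings / 0 proof-hole; lean -DautoImplicit=false (`HOME/pub-hodgecm-qw8-g11/lean/Qw8g11/LefQuarticQuadLift.lean`, md5 cc8dddc4, 322 lines);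
landed by the packager successor (mc-unitary-1-g3, gen-8 kit) in gate run 32 as `HodgeCM/Model/Toy/LefQuarticQuadLift.lean` (verbatim).
-/
-- HANDOVER (planner-pub-hodgecm-qw8-g11-0, unit pub-hodgecm-qw8-g11): SPLIT PART 1/2 of the installed
-- `HodgeCM.Model.Toy.LefQuarticQuad` (md5 5e74bc2b, 626 l.; 400-line cap, lean/CONVENTIONS.md) = its §§1–4 (ll. 51–316)
-- verbatim + docstrings; WIP module `Qw8g11.LefQuarticQuadLift`, intended final module `HodgeCM.Model.Toy.LefQuarticQuadLift`
-- (NEW file; tree imports only, NO rewrite).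
/-
Copyright (c) 2026. All rights reserved.
Released under Apache 2.0 license as described in the file LICENSE.
-/
import Mathlib
import Summits.HodgeConjecture.HodgeCM.Model.Toy.LefQuadMixed

/-!
# Pair orbits of two slots: lifting `Ω_X` to `Aut_ℚ(ℚ̄)` and pushing pair sums forward

Split part 1/2 of `HodgeCM.Model.Toy.LefQuarticQuad` (its §§1–4, unchanged): the machinery that pushes the pair sums
`Σ_{ω ∈ Ω_X} sg(ω s) sg(ω t)` of `LefQuadMixed` §3 forward along `ω ↦ (ω·x, ω·y)` to the finite PAIR ORBIT of the two slots
read in their presenting fields: §1 the group-free orbit–stabiliser count of `LefQuartic` §5 with the intertwining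
hypothesis asked only on the finite set (`card_fibre_eq_of_homogeneous'`), trichotomy bookkeeping (`Trichot.of_mul`, …) and
sign sums over few embeddings; §2 lifting elements of `Ω_X` back to `Aut_ℚ(ℚ̄)` (`Obj.glift`) and reading slots in a
presenting field; §3 atoms presented over a field (`Obj.PresentedAt`, `Obj.QuadPresentedAt`) and `Ω_X` as a homogeneous
space (`Omega_transitive`); §4 two slots over the same field `K`: push-forward to `LefQuartic`'s pair orbit
(`trichot_of_presentedAt`). The `K`-slot-against-`k`-slot analysis, mixed data and the headlines are in
`HodgeCM.Model.Toy.LefQuarticQuad`. Nothing is cited: kernel facts about an explicit model.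
-/

noncomputable section

set_option backward.isDefEq.respectTransparency false

namespace HodgeCM.Toy

open scoped TensorProduct
open exteriorPower Module CMPresentation CMTypeOps
open NumberField.ComplexEmbedding (conjugate)
open Literature.AlgebraicGeometry.Motives

/-! ### 1. Homogeneity with the intertwining hypothesis only on the finite set -/

section Homogeneous'

variable {ι α β : Type*} [DecidableEq β] {S : Finset α} {a : ι → α → α}
  (hS : ∀ i, ∀ s ∈ S, a i s ∈ S) (hinj : ∀ i, Function.Injective (a i))
  (htr : ∀ s ∈ S, ∀ t ∈ S, ∃ i, a i s = t) {F : α → β} {act : ι → β → β}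
  (hF : ∀ i, ∀ s ∈ S, F (a i s) = act i (F s))
include hS hinj htr hF

/-- `LefQuartic`'s `card_fibre_eq_of_homogeneous` with the intertwining asked only on `S` -/
theorem card_fibre_eq_of_homogeneous' {s t : α} (hs : s ∈ S) (ht : t ∈ S) :
    (S.filter fun u => F u = F s).card = (S.filter fun u => F u = F t).card := by
  have key : ∀ {s t : α}, s ∈ S → t ∈ S →
      (S.filter fun u => F u = F s).card ≤ (S.filter fun u => F u = F t).card := by
    intro s t hs ht
    obtain ⟨i, hi⟩ := htr s hs t ht
    refine Finset.card_le_card_of_injOn (a i) (fun u hu => ?_) (hinj i).injOn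
    rw [Finset.mem_coe, Finset.mem_filter] at hu ⊢
    exact ⟨hS i u hu.1, by rw [hF i u hu.1, hu.2, ← hF i s hs, hi]⟩
  exact le_antisymm (key hs ht) (key ht hs)

/-- push-forward of a sum along `F`: on a finite homogeneous space with equal fibres, `∑_{u ∈ S} h
(F u)` is the common fibre size times the sum of `h` over the image `F(S)` -/
theorem sum_eq_card_fibre_mul_sum' (h : β → ℤ) {s₀ : α} (hs₀ : s₀ ∈ S) :
    ∑ u ∈ S, h (F u) = ((S.filter fun u => F u = F s₀).card : ℤ) * ∑ b ∈ S.image F, h b := by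
  rw [Finset.sum_comp, Finset.mul_sum]
  refine Finset.sum_congr rfl fun b hb => ?_
  obtain ⟨t, ht, rfl⟩ := Finset.mem_image.mp hb
  rw [nsmul_eq_mul, card_fibre_eq_of_homogeneous' hS hinj htr hF ht hs₀]

/-- orbit–stabiliser count: `#S` = (common fibre size of `F`) · `#F(S)` -/
theorem card_eq_card_fibre_mul' {s₀ : α} (hs₀ : s₀ ∈ S) :
    S.card = (S.filter fun u => F u = F s₀).card * (S.image F).card := by
  rw [Finset.card_eq_sum_card_image F S, mul_comm, ← smul_eq_mul, ← Finset.sum_const]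
  refine Finset.sum_congr rfl fun b hb => ?_
  obtain ⟨t, ht, rfl⟩ := Finset.mem_image.mp hb
  rw [card_fibre_eq_of_homogeneous' hS hinj htr hF ht hs₀]

end Homogeneous'

/-- a trichotomy scales down along a positive factor -/
theorem Trichot.of_mul {n c : ℕ} (hc : 0 < c) {v : ℤ} (h : Trichot (c * n) (c * v)) : Trichot n v := by
  have hc' : (c : ℤ) ≠ 0 := by exact_mod_cast hc.ne'
  rcases h with h | h | h
  · exact Or.inl ((mul_eq_zero.mp h).resolve_left hc')
  · right; left
    push_cast at h
    exact mul_left_cancel₀ hc' h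
  · right; right
    push_cast at h
    rw [← mul_neg] at h
    exact mul_left_cancel₀ hc' h

/-! Sign sums over few embeddings. -/

section SignSums

variable {K : Type} [Field K] [NumberField K] [DecidableEq (K →+* ℂ)]

/-- a trichotomy is invariant under `v ↦ -v` -/
theorem Trichot.neg_iff {n : ℕ} {v : ℤ} : Trichot n (-v) ↔ Trichot n v := by
  unfold Trichot
  constructor
  · rintro (h | h | h)
    · exact Or.inl (neg_eq_zero.mp h)
    · exact Or.inr (Or.inr (by rw [← h, neg_neg]))
    · exact Or.inr (Or.inl (by rw [← neg_neg (n : ℤ), ← h, neg_neg]))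
  · rintro (h | h | h)
    · exact Or.inl (by rw [h, neg_zero])
    · exact Or.inr (Or.inr (by rw [h]))
    · exact Or.inr (Or.inl (by rw [h, neg_neg]))

omit [NumberField K] in
/-- a sum of `sgn_Ψ` over at most two embeddings is `0` or `±` the number of terms … -/
theorem trichot_sum_sgn_of_card_le_two (Ψ : CMType K) (T : Finset (K →+* ℂ)) (hT : T.card ≤ 2) :
    Trichot T.card (∑ a ∈ T, sgn Ψ a) := by
  rcases Nat.lt_or_ge T.card 2 with h2 | h2
  · rcases Nat.lt_or_ge T.card 1 with h1 | h1
    · have h0 : T = ∅ := Finset.card_eq_zero.mp (show T.card = 0 by omega)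
      subst h0
      exact Or.inl (by simp)
    · obtain ⟨a, rfl⟩ := Finset.card_eq_one.mp (show T.card = 1 by omega)
      rw [Finset.sum_singleton, Finset.card_singleton]
      rcases sgn_eq_or Ψ a with h | h
      · exact Or.inr (Or.inl (by rw [h]; rfl))
      · exact Or.inr (Or.inr (by rw [h]; rfl))
  · obtain ⟨a, b, hab, rfl⟩ := Finset.card_eq_two.mp (le_antisymm hT h2)
    rw [Finset.sum_pair hab, Finset.card_pair hab]
    rcases sgn_eq_or Ψ a with ha | ha <;> rcases sgn_eq_or Ψ b with hb | hb
    · exact Or.inr (Or.inl (by rw [ha, hb]; rfl))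
    · exact Or.inl (by rw [ha, hb]; rfl)
    · exact Or.inl (by rw [ha, hb]; rfl)
    · exact Or.inr (Or.inr (by rw [ha, hb]; rfl))

omit [DecidableEq (K →+* ℂ)] in
/-- … and over all embeddings it is `0` -/
theorem trichot_sum_sgn_univ (Ψ : CMType K) :
    Trichot (Finset.univ : Finset (K →+* ℂ)).card (∑ a, sgn Ψ a) :=
  Or.inl (by convert sum_sgn_univ Ψ)

end SignSums

namespace Obj

variable (X : Obj)

/-! ### 2. Lifting elements of `Ω_X` back to `Aut_ℚ(ℚ̄)` and reading slots in a presenting field -/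

section Lift

open scoped Classical

/-- a preimage in `Aut_ℚ(ℚ̄)` of an element of `Ω_X` (junk `1` off `Ω_X`) -/
def glift (ω : X.Idx → X.Idx) : Gam := if h : ∃ γ : Gam, ω = X.gact γ then h.choose else 1

/-- `glift ω` acts on eigen-indices as `ω`, for `ω ∈ Ω_X` -/
theorem gact_glift {ω : X.Idx → X.Idx} (hω : ω ∈ X.Omega) : X.gact (X.glift ω) = ω := by
  obtain ⟨γ, hγ⟩ := mem_Omega.mp hω
  have h : ∃ γ : Gam, ω = X.gact γ := ⟨γ, hγ⟩
  rw [glift, dif_pos h]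
  exact h.choose_spec.symm

variable {K : Type} [Field K] [NumberField K]

/-- the twist of a slot read in a subfield only depends on the Galois action on the eigen-index -/
theorem twist_congr_gact {γ₁ γ₂ : Gam} {i : X.s.toType} {τ : (X.atom i).F →+* ℂ}
    (h : X.gact γ₁ ⟨i, τ⟩ = X.gact γ₂ ⟨i, τ⟩) (e : K →+* (X.atom i).F) :
    twist γ₁ (τ.comp e) = twist γ₂ (τ.comp e) := by
  have h2 : (X.gact γ₁ ⟨i, τ⟩).2 = (X.gact γ₂ ⟨i, τ⟩).2 := eq_of_heq (Sigma.ext_iff.mp h).2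
  rw [← gact_snd_comp, ← gact_snd_comp, h2]

/-- on an embedding read in a presenting field `K`, the lift of the action of `δ` twists like `δ`
itself -/
theorem twist_glift_gact (δ : Gam) {i : X.s.toType} (τ : (X.atom i).F →+* ℂ) (e : K →+* (X.atom i).F) :
    twist (X.glift (X.gact δ)) (τ.comp e) = twist δ (τ.comp e) :=
  X.twist_congr_gact (congrFun (X.gact_glift (X.gact_mem_Omega δ)) ⟨i, τ⟩) e

/-- … multiplicatively: lifting `γ ∘ ω` twists a slot by `γ` after the lift of `ω` -/
theorem twist_glift_comp (γ : Gam) {ω : X.Idx → X.Idx} (hω : ω ∈ X.Omega) {i : X.s.toType}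
    (τ : (X.atom i).F →+* ℂ) (e : K →+* (X.atom i).F) :
    twist (X.glift fun s => X.gact γ (ω s)) (τ.comp e) = twist γ (twist (X.glift ω) (τ.comp e)) := by
  obtain ⟨δ, rfl⟩ := mem_Omega.mp hω
  have h1 : (fun s => X.gact γ (X.gact δ s)) = X.gact (γ * δ) := funext fun s => (X.gact_mul γ δ s).symm
  rw [h1, twist_glift_gact, twist_glift_gact, twist_mul]

/-- **reading a slot in a presenting field**: if atom `i` has CM type induced along `e : K → F_i` from
`Ψ`, the sign of `ω • (i,τ)` is `sgn_Ψ` of the twist of `τ ∘ e` by (a lift of) `ω` -/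
theorem sg_eq_sgn_twist_glift {i : X.s.toType} {Ψ : CMType K} {e : K →+* (X.atom i).F}
    (he : ∀ τ : (X.atom i).F →+* ℂ, τ ∈ (X.atom i).Φ ↔ τ.comp e ∈ Ψ.1)
    {ω : X.Idx → X.Idx} (hω : ω ∈ X.Omega) (τ : (X.atom i).F →+* ℂ) :
    X.sg (ω ⟨i, τ⟩) = sgn Ψ (twist (X.glift ω) (τ.comp e)) := by
  obtain ⟨δ, rfl⟩ := mem_Omega.mp hω
  rw [twist_glift_gact]
  have hhol : X.hol (X.gact δ ⟨i, τ⟩) ↔ twist δ (τ.comp e) ∈ Ψ.1 := by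
    show (X.gact δ ⟨i, τ⟩).2 ∈ (X.atom i).Φ ↔ _
    rw [he, gact_snd_comp]
  by_cases h : X.hol (X.gact δ ⟨i, τ⟩)
  · rw [sg_of_hol h, sgn_of_mem (hhol.mp h)]
  · rw [sg_of_not_hol h, sgn_of_not_mem (fun h' => h (hhol.mpr h'))]

end Lift

/-! ### 3. Atoms presented over a field; `Ω_X` as a homogeneous space -/

section PresentedAt

variable (K : Type) [Field K] [NumberField K]

/-- atom `i` of `X` is presented over `K`: its CM type is induced along some `e : K → F_i` from a CM type
`Ψ` of `K` -/
def PresentedAt (i : X.s.toType) : Prop :=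
  ∃ (Ψ : CMType K) (e : K →+* (X.atom i).F),
    ∀ τ : (X.atom i).F →+* ℂ, τ ∈ (X.atom i).Φ ↔ τ.comp e ∈ Ψ.1

variable {K} {X}

/-- an object presented over `K` has every atom presented over `K` -/
theorem presentedAt_of_presented {K : CMField} (h : X.Presented K) (i : X.s.toType) :
    X.PresentedAt K i := by
  obtain ⟨Ψ, e, he⟩ := h
  exact ⟨Ψ i, e i, he i⟩

/-- an atom presented over an imaginary quadratic field is quadratic-presented -/
theorem quadPresentedAt_of_presentedAt {k : CMField} (hk : Module.finrank ℚ k = 2) {i : X.s.toType}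
    (h : X.PresentedAt k i) : X.QuadPresentedAt i := by
  obtain ⟨Ψ, e, he⟩ := h
  exact ⟨k, hk, Ψ, e, he⟩

/-- a quadratic-presented atom is presented over some imaginary quadratic CM field -/
theorem presentedAt_of_quadPresentedAt {i : X.s.toType} (h : X.QuadPresentedAt i) :
    ∃ (k : CMField), Module.finrank ℚ k = 2 ∧ X.PresentedAt k i := by
  obtain ⟨k, hk, Ψ, e, he⟩ := h
  exact ⟨k, hk, Ψ, e, he⟩

end PresentedAt

section OmegaHomogeneous

open scoped Classical

/-- post-composition with the action of `γ` maps `Ω_X` into itself -/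
theorem Omega_mapsTo (γ : Gam) : ∀ ω ∈ X.Omega, (fun s => X.gact γ (ω s)) ∈ X.Omega :=
  fun _ hω => X.comp_mem_Omega γ hω

/-- post-composition with the action of `γ` is injective on index maps -/
theorem comp_gact_injective (γ : Gam) :
    Function.Injective fun (ω : X.Idx → X.Idx) => fun s => X.gact γ (ω s) :=
  fun _ _ h => funext fun s => X.gact_injective γ (congrFun h s)

/-- `Ω_X` is a homogeneous space under post-composition: any two elements differ by the action of
some `γ` -/
theorem Omega_transitive :
    ∀ ω ∈ X.Omega, ∀ ω' ∈ X.Omega, ∃ γ : Gam, (fun s => X.gact γ (ω s)) = ω' := by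
  intro ω hω ω' hω'
  obtain ⟨δ, rfl⟩ := mem_Omega.mp hω
  obtain ⟨δ', rfl⟩ := mem_Omega.mp hω'
  refine ⟨δ' * δ.symm, funext fun s => ?_⟩
  show X.gact (δ' * δ.symm) (X.gact δ s) = X.gact δ' s
  rw [gact_mul, gact_symm_gact]

end OmegaHomogeneous

/-! ### 4. Two slots over the same field `K`: push forward to `LefQuartic`'s pair orbit -/

section KK

open scoped Classical

variable {K : CMField}

/-- **two `K`-slots**: the pair sum over `Ω_X` is a positive multiple of the pair sum over the pair orbit
`O_{x,y} ⊆ Hom(K,ℂ)²` of the slots read in `K`, so `TriInner K` gives the trichotomy. -/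
theorem trichot_of_presentedAt (hT : TriInner K) {s t : X.Idx} (hs : X.PresentedAt K s.1)
    (ht : X.PresentedAt K t.1) :
    Trichot X.Omega.card (∑ ω ∈ X.Omega, X.sg (ω s) * X.sg (ω t)) := by
  obtain ⟨i, τ⟩ := s
  obtain ⟨i', τ'⟩ := t
  obtain ⟨Ψ, e, he⟩ := hs
  obtain ⟨Ψ', e', he'⟩ := ht
  obtain ⟨x, hx⟩ : ∃ x : K →+* ℂ, x = τ.comp e := ⟨_, rfl⟩
  obtain ⟨y, hy⟩ : ∃ y : K →+* ℂ, y = τ'.comp e' := ⟨_, rfl⟩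
  obtain ⟨P, hP⟩ : ∃ P : (X.Idx → X.Idx) → (K →+* ℂ) × (K →+* ℂ),
      ∀ ω, P ω = (twist (X.glift ω) x, twist (X.glift ω) y) := ⟨_, fun _ => rfl⟩
  obtain ⟨h, hh⟩ : ∃ h : (K →+* ℂ) × (K →+* ℂ) → ℤ, ∀ q, h q = sgn Ψ q.1 * sgn Ψ' q.2 :=
    ⟨_, fun _ => rfl⟩
  have hsum : ∑ ω ∈ X.Omega, X.sg (ω ⟨i, τ⟩) * X.sg (ω ⟨i', τ'⟩) = ∑ ω ∈ X.Omega, h (P ω) :=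
    Finset.sum_congr rfl fun ω hω => by
      rw [hh, hP, X.sg_eq_sgn_twist_glift he hω, X.sg_eq_sgn_twist_glift he' hω, hx, hy]
  have hF : ∀ γ : Gam, ∀ ω ∈ X.Omega,
      P (fun s => X.gact γ (ω s)) = Prod.map (twist γ) (twist γ) (P ω) := by
    intro γ ω hω
    rw [hP, hP, Prod.map_apply, hx, hy, X.twist_glift_comp γ hω, X.twist_glift_comp γ hω]
  have himage : X.Omega.image P = pairSet x y := by
    ext q
    rw [Finset.mem_image, mem_pairSet]
    constructor
    · rintro ⟨ω, hω, rfl⟩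
      obtain ⟨δ, rfl⟩ := mem_Omega.mp hω
      exact ⟨δ, by rw [hP, hx, hy, twist_glift_gact, twist_glift_gact]⟩
    · rintro ⟨γ, rfl⟩
      exact ⟨X.gact γ, X.gact_mem_Omega γ, by rw [hP, hx, hy, twist_glift_gact, twist_glift_gact]⟩
  have h1 := X.gact_mem_Omega 1
  have key := sum_eq_card_fibre_mul_sum' (X.Omega_mapsTo) (X.comp_gact_injective) (X.Omega_transitive)
    hF h h1
  have keyc := card_eq_card_fibre_mul' (X.Omega_mapsTo) (X.comp_gact_injective) (X.Omega_transitive)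
    hF h1
  rw [himage] at key keyc
  have hpair : Trichot (pairSet x y).card (∑ q ∈ pairSet x y, h q) := by
    have h2 := hT Ψ Ψ' x y
    rw [sum_twistSet_eval₂ x y (fun q => sgn Ψ q.1 * sgn Ψ' q.2), card_twistSet_eq₂ x y] at h2
    have h3 : ∑ q ∈ pairSet x y, h q = ∑ q ∈ pairSet x y, sgn Ψ q.1 * sgn Ψ' q.2 :=
      Finset.sum_congr rfl fun q _ => hh q
    rw [h3]
    refine Trichot.of_mul ?_ h2
    exact Finset.card_pos.mpr ⟨id, Finset.mem_filter.mpr ⟨id_mem_twistSet, rfl⟩⟩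
  rw [hsum, key, keyc]
  exact hpair.mul _

end KK

end Obj

end HodgeCM.Toy

end
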